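import Summits.ResolutionOfSingularities.ResolutionOfSingularities.Theorems.FrobeniusLadderFInjectiveMacaulayficationOffOriginClauseOfFedderCertificates
import Summits.ResolutionOfSingularities.ResolutionOfSingularities.Theorems.FrobeniusLadderFInjectiveMacaulayficationPrimeTransfer
import Mathlib.RingTheory.Localization.Ideal
import HarnessLib

/-!
# (G2) THE UNIFORM FEDDER CELL `KLocCell` OF ONE STRATUM, and the naive-chart hypothesis `hon'` of the CI-certificate door from
# the strata cover and the cells (hypersurface charts, `r = 1`)
# (crux `FInjectiveMacaulayfication`, road B «K-loc certificate → `CICertificates.ciCertificates`»; statements of record =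
# res-L1-w45a-plan-1's `L/w45a/ToricCertSig.lean` v1.1 sha16 `dfad821d8a675d80` §2 / §3 (Sig v12.2, R12.11 (c), R12.12 (a)), VERBATIM)

Support file for crux stmt-ResolutionOfSingularities-15315 (`FrobeniusLadder.FInjectiveMacaulayfication`), chain w45a, seat
res-L1-w45a-stub-1. [OURS · L1 W4.5a] — NOT a statement of the manuscript [claim: Hironaka2017]; AI-written, weaker than expert
review. No statement of the manuscript is used.

THE CELL `KLocCell(g; S)` (res-L1-w45a-tri-1's «p-th-root split + cofactors» as a Lean currency). `g ∈ k[Y]` (`char k = p`, ANY field —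
no perfectness, no Frobenius on coefficients), a stratum `S ⊆ Fin n`, and the DATA
  (split)      `g^(p-1) = Σ_{e ∈ L} Y^{e.1} · expand p e.2` — `L` a finite list, exponents `e.1 < p` coordinatewise, pairwise distinct;
  (cofactors)  `1 = Σ rr_e · expand p e.2 + Σ_{i ∈ S} t i · Y_i + t₀ · g`,
both checkable by computable polynomial arithmetic. At a `K`-point `a` with `a_i = 0 (i ∈ S)` and `g(a) = 0` the cofactor identity
gives some `(expand p e.2)(a) ≠ 0`; by distinctness of the reduced exponents this is ONE non-vanishing `p`-coefficient of the
function-indexed split `g^(p-1) = Σ_α ψ_p(c_α) · Y^α`, so res-L1-w45a-stub-3's certificate-free core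
`FaceFPureOfMonomialPCoeff.fedder_of_aeval_expand_ne_zero` yields FEDDER'S TEST `(g ⊗ K)^(p-1) ∉ ((Y_i − a_i)^p : i)`.

* §1 `aeval_zipWith_sum_eq_zero`, `exists_aeval_expand_ne_zero` — the cofactor identity forces a non-vanishing split component;
* §2 `fedderAt_of_kLocCell` — **(G2) FEDDER'S TEST AT EVERY POINT OF ONE STRATUM FROM ITS CELL** = Sig §2 `stub_fedderAt_of_kLocCell`
  VERBATIM (list split ⟶ function-indexed split over `L.toFinset`, fibrewise in the residue class `α = e.1 mod p`);
* §3 `isSMulRegular_localization_quotient_of_prime_not_dvd` — ORBIT BINDER for hypersurfaces: a prime element `q ∤ g` of a domain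
  `A` is a non-zero-divisor on `A_P ⧸ (g)A_P` (used with `q = Y_i`, `PrimeTransfer.prime_X`);
  `quotientChartClause_of_pointFedder` — `hon'` (`Ideal.span {g}` form) from `g ≠ 0`, `Y_i ∤ g` and Fedder's test at every `K`-point of
  `V(g) ∩ V(θ(X_j) : j ∈ J)` (residue point + (C3a) `FrobeniusPowerOfFedderAt.frobeniusPower_of_fedderAt` +
  `FedderAtMaximalIdeal.stub_fedderAtMaximalIdeal`); `pointFedder_of_kLocCells` — the COVER condition («every `T ⊆ Fin n` meeting the
  support of each column `j ∈ J` of `V` contains a listed stratum») + one cell per listed stratum ⟹ that point-Fedder hypothesis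
  (the orthant `T = {i : a_i = 0}` of a point under `θ(X_J)` meets every column); `honQuot_of_kLocCells` — **Sig §3
  `stub_honQuot_of_kLocCells` VERBATIM**;
* the same two theorems over `gs : Fin 1 → k[Y]` / `Ideal.span (Set.range gs)` — LITERALLY the `hon' c` binder of
  `CICertificates.ciCertificates` at `r = 1` — are the sequel file `…KLocCellRange.lean`.

No definitions, no named facts; glue. [cite: Fedder1983, Prop. 1.7 and Thm. 1.12 (criterion); folklore otherwise]
-/

-- single-problem summit: the doubled namespace component is forced
set_option linter.dupNamespace false

noncomputable section

namespace Summit.ResolutionOfSingularities.ResolutionOfSingularities.Theorems.FInjectiveMacaulayfication.KLocCell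

open MvPolynomial
open Summit.ResolutionOfSingularities.ResolutionOfSingularities.Theorems.FInjectiveMacaulayfication
open Literature.RingTheory.TightClosure

/-! ## §1 The cofactor identity forces a non-vanishing split component -/

/-- Evaluation kills a `zipWith`-sum whose second factors it kills. [folklore] -/
theorem aeval_zipWith_sum_eq_zero {k : Type} [Field k] {n : ℕ} (p : ℕ) {K : Type} [CommRing K] [Algebra k K]
    (a : Fin n → K) : ∀ (rr : List (MvPolynomial (Fin n) k)) (L : List ((Fin n →₀ ℕ) × MvPolynomial (Fin n) k)),
      (∀ e ∈ L, aeval a (MvPolynomial.expand p e.2) = 0) →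
        aeval a (List.zipWith (fun r e => r * MvPolynomial.expand p e.2) rr L).sum = 0
  | [], L, _ => by simp
  | r :: rr, [], _ => by simp
  | r :: rr, e :: L, h => by
      rw [List.zipWith_cons_cons, List.sum_cons, map_add, map_mul, h e (by simp), mul_zero, zero_add]
      exact aeval_zipWith_sum_eq_zero p a rr L fun e' he' => h e' (by simp [he'])

/-- **The cofactor identity at a point of the stratum on `V(g)`**: `1 = Σ rr_e · expand p e.2 + Σ_{i ∈ S} t i · Y_i + t₀ · g`
evaluated at `a` with `a_i = 0 (i ∈ S)`, `g(a) = 0` leaves some `(expand p e.2)(a) ≠ 0`. [folklore] -/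
theorem exists_aeval_expand_ne_zero {p : ℕ} {k : Type} [Field k] {n : ℕ} (S : Finset (Fin n)) (g : MvPolynomial (Fin n) k)
    (L : List ((Fin n →₀ ℕ) × MvPolynomial (Fin n) k)) (rr : List (MvPolynomial (Fin n) k))
    (t : Fin n → MvPolynomial (Fin n) k) (t₀ : MvPolynomial (Fin n) k)
    (hcof : (1 : MvPolynomial (Fin n) k) = (List.zipWith (fun r e => r * MvPolynomial.expand p e.2) rr L).sum +
      ∑ i ∈ S, t i * MvPolynomial.X i + t₀ * g)
    {K : Type} [Field K] [Algebra k K] (a : Fin n → K) (haS : ∀ i ∈ S, a i = 0) (hga : MvPolynomial.aeval a g = 0) :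
    ∃ e ∈ L, aeval a (MvPolynomial.expand p e.2) ≠ 0 := by
  by_contra hall
  push Not at hall
  have h := congrArg (MvPolynomial.aeval a) hcof
  rw [map_one, map_add, map_add, aeval_zipWith_sum_eq_zero p a rr L hall, map_sum, map_mul, hga, mul_zero, add_zero,
    zero_add] at h
  refine one_ne_zero (h.trans (Finset.sum_eq_zero fun i hi => ?_))
  rw [map_mul, MvPolynomial.aeval_X, haS i hi, mul_zero]

/-! ## §2 (G2) Fedder's test at every point of one stratum from its cell -/

/-- **(G2) FEDDER'S TEST AT EVERY POINT OF ONE STRATUM FROM ITS CELL** (`L/w45a/ToricCertSig.lean` v1.1 `dfad821d8a675d80` §2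
`stub_fedderAt_of_kLocCell`, VERBATIM). With a distinct-exponent split `g^(p-1) = Σ_{e ∈ L} Y^{e.1} · expand p e.2` (`e.1 < p`) and
cofactors `1 = Σ rr_e · expand p e.2 + Σ_{i∈S} t i · Y_i + t₀ · g`: for every field `K ⊇ k` and every `K`-point `a` with `a_i = 0`
(`i ∈ S`) and `g(a) = 0`, `(g ⊗ K)^(p-1) ∉ ((Y_i − a_i)^p : i)`. Proof: regroup the split by residue classes `α = e.1 mod p` over
`L.toFinset` (each fibre is a singleton by distinctness), so the non-vanishing `(expand p e.2)(a)` of §1 is a non-vanishing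
`p`-coefficient, and apply `FaceFPureOfMonomialPCoeff.fedder_of_aeval_expand_ne_zero`. [folklore; cite: Fedder1983, Prop. 1.7 (the test)] -/
theorem fedderAt_of_kLocCell : ∀ (p : ℕ) [Fact p.Prime] (k : Type) [Field k] [CharP k p] (n : ℕ)
    (S : Finset (Fin n)) (g : MvPolynomial (Fin n) k)
    (L : List ((Fin n →₀ ℕ) × MvPolynomial (Fin n) k)) (rr : List (MvPolynomial (Fin n) k))
    (t : Fin n → MvPolynomial (Fin n) k) (t₀ : MvPolynomial (Fin n) k),
    (L.map Prod.fst).Nodup → (∀ e ∈ L, ∀ i : Fin n, e.1 i < p) →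
    g ^ (p - 1) = (L.map fun e => MvPolynomial.monomial e.1 (1 : k) * MvPolynomial.expand p e.2).sum →
    (1 : MvPolynomial (Fin n) k) = (List.zipWith (fun r e => r * MvPolynomial.expand p e.2) rr L).sum +
      ∑ i ∈ S, t i * MvPolynomial.X i + t₀ * g →
    ∀ (K : Type) [Field K] [Algebra k K] (a : Fin n → K), (∀ i ∈ S, a i = 0) → MvPolynomial.aeval a g = 0 →
      (MvPolynomial.map (algebraMap k K) g) ^ (p - 1) ∉
        Ideal.span (Set.range fun i : Fin n => (MvPolynomial.X i - MvPolynomial.C (a i)) ^ p):= by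
  intro p _ k _ _ n S g L rr t t₀ hnd hbd hsplit hcof K _ _ a haS hga
  classical
  have hp : 0 < p := (Fact.out : p.Prime).pos
  -- residue classes of the (reduced) exponents
  let cls : (Fin n →₀ ℕ) → (Fin n → Fin p) := fun γ j => ⟨γ j % p, Nat.mod_lt _ hp⟩
  have hcls : ∀ e ∈ L, (Finsupp.equivFunOnFinite.symm fun j => ((cls e.1 j : ℕ)) : Fin n →₀ ℕ) = e.1 := by
    intro e he
    ext j
    simp only [Finsupp.coe_equivFunOnFinite_symm, cls]
    exact Nat.mod_eq_of_lt (hbd e he j)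
  have hinj : ∀ e ∈ L, ∀ e' ∈ L, cls e.1 = cls e'.1 → e = e' := by
    intro e he e' he' h
    have h2 := congrArg (fun β : Fin n → Fin p => (Finsupp.equivFunOnFinite.symm fun j => ((β j : ℕ)) : Fin n →₀ ℕ)) h
    rw [hcls e he, hcls e' he'] at h2
    exact List.inj_on_of_nodup_map hnd he he' h2
  have hL : L.Nodup := List.Nodup.of_map _ hnd
  -- the function-indexed split over the residue classes
  let c : (Fin n → Fin p) → MvPolynomial (Fin n) k := fun α => ∑ e ∈ L.toFinset with cls e.1 = α, e.2
  have hF : g ^ (p - 1) = ∑ α : Fin n → Fin p, MvPolynomial.expand p (c α) *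
      MvPolynomial.monomial (Finsupp.equivFunOnFinite.symm fun j => ((α j : ℕ))) 1 := by
    rw [hsplit, ← List.sum_toFinset _ hL]
    symm
    calc ∑ α : Fin n → Fin p, MvPolynomial.expand p (c α) *
          MvPolynomial.monomial (Finsupp.equivFunOnFinite.symm fun j => ((α j : ℕ))) 1
        = ∑ α : Fin n → Fin p, ∑ e ∈ L.toFinset with cls e.1 = α,
            MvPolynomial.monomial e.1 (1 : k) * MvPolynomial.expand p e.2 := by
          refine Finset.sum_congr rfl fun α _ => ?_
          simp only [c, map_sum, Finset.sum_mul]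
          refine Finset.sum_congr rfl fun e he => ?_
          rw [Finset.mem_filter] at he
          rw [mul_comm, ← he.2, hcls e (List.mem_toFinset.mp he.1)]
      _ = ∑ e ∈ L.toFinset, MvPolynomial.monomial e.1 (1 : k) * MvPolynomial.expand p e.2 :=
          Finset.sum_fiberwise L.toFinset (fun e => cls e.1) _
  -- a non-vanishing `p`-coefficient at `a`
  obtain ⟨e₀, he₀, hne⟩ := exists_aeval_expand_ne_zero S g L rr t t₀ hcof a haS hga
  have hc : aeval a (MvPolynomial.expand p (c (cls e₀.1))) = aeval a (MvPolynomial.expand p e₀.2) := by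
    simp only [c, map_sum]
    refine Finset.sum_eq_single_of_mem e₀ (Finset.mem_filter.mpr ⟨List.mem_toFinset.mpr he₀, rfl⟩) fun e he hne' => ?_
    exact absurd (hinj e (List.mem_toFinset.mp (Finset.mem_filter.mp he).1) e₀ he₀ (Finset.mem_filter.mp he).2) hne'
  exact FaceFPureOfMonomialPCoeff.fedder_of_aeval_expand_ne_zero p g c hF a ⟨cls e₀.1, by rw [hc]; exact hne⟩

/-! ## §3 `hon'` of one hypersurface chart from the strata cover and the cells -/

/-- **A prime element `q ∤ g` of a domain `A` is a non-zero-divisor on `A_P ⧸ (g)·A_P`** (for any prime `P`): if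
`q·(a/u) ∈ (g)A_P` then `v·q·a ∈ (g)` for some `v ∉ P`, so `q ∣ g·c` forces `q ∣ c` and `v·a ∈ (g)`. [folklore] -/
theorem isSMulRegular_localization_quotient_of_prime_not_dvd {A : Type} [CommRing A] [IsDomain A] (P : Ideal A) [P.IsPrime]
    {q g : A} (hq : Prime q) (hqg : ¬ q ∣ g) (I : Ideal A) (hI : I = Ideal.span {g}) :
    IsSMulRegular (Localization.AtPrime P ⧸ I.map (algebraMap A (Localization.AtPrime P)))
      (algebraMap A (Localization.AtPrime P) q) := by
  subst hI
  -- the colon condition `q·y ∈ (g)A_P ⇒ y ∈ (g)A_P`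
  have hcolon : ∀ y : Localization.AtPrime P,
      algebraMap A (Localization.AtPrime P) q * y ∈ (Ideal.span {g}).map (algebraMap A (Localization.AtPrime P)) →
        y ∈ (Ideal.span {g}).map (algebraMap A (Localization.AtPrime P)) := by
    intro y hy
    obtain ⟨⟨a, u⟩, rfl⟩ := IsLocalization.mk'_surjective P.primeCompl y
    dsimp only at hy ⊢
    rw [IsLocalization.mul_mk'_eq_mk'_of_mul] at hy
    rw [IsLocalization.mk'_mem_map_algebraMap_iff] at hy ⊢
    obtain ⟨v, hv, hvqa⟩ := hy
    refine ⟨v, hv, ?_⟩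
    rw [Ideal.mem_span_singleton] at hvqa ⊢
    obtain ⟨c, hc⟩ := hvqa
    have hqc : q ∣ g * c := ⟨v * a, by rw [← hc]; ring⟩
    rcases hq.dvd_or_dvd hqc with hqg' | ⟨c', rfl⟩
    · exact absurd hqg' hqg
    · refine ⟨c', mul_left_cancel₀ hq.ne_zero ?_⟩
      linear_combination hc
  intro m₁ m₂ h
  obtain ⟨y₁, rfl⟩ := Ideal.Quotient.mk_surjective m₁
  obtain ⟨y₂, rfl⟩ := Ideal.Quotient.mk_surjective m₂
  have hsm : ∀ y : Localization.AtPrime P, algebraMap A (Localization.AtPrime P) q •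
      (Ideal.Quotient.mk ((Ideal.span {g}).map (algebraMap A (Localization.AtPrime P))) y) =
        Ideal.Quotient.mk ((Ideal.span {g}).map (algebraMap A (Localization.AtPrime P)))
          (algebraMap A (Localization.AtPrime P) q * y) := fun y => rfl
  change algebraMap A (Localization.AtPrime P) q • Ideal.Quotient.mk _ y₁ =
    algebraMap A (Localization.AtPrime P) q • Ideal.Quotient.mk _ y₂ at h
  rw [hsm, hsm, Ideal.Quotient.eq, ← mul_sub] at h
  rw [Ideal.Quotient.eq]
  exact hcolon _ h

section Chart

variable (p : ℕ) [Fact p.Prime] (k : Type) [Field k] [CharP k p] (n : ℕ)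

/-- **`hon'` FROM POINT-FEDDER (`Ideal.span {g}` form).** For a hypersurface chart `k[Y]/(g)` with `g ≠ 0`, no variable dividing
`g`, and Fedder's test for `g ⊗ K` at every `K`-point of `V(g) ∩ V(θ(X_j) : j ∈ J)` (`θ(X_j) = ∏_i Y_i^(V i j)`, `K ⊇ k` any field): at
every maximal `Q' ∋ θ(X_j) (j ∈ J)` of `k[Y]/(g)`, (i) the variables in `Q'` are non-zero-divisors on `k[Y]_(Q') ⧸ (g)` and
(ii) `(k[Y]/(g))_(Q')` satisfies the Cohen–Macaulay + Frobenius-closed clause of the crux. [cite: Fedder1983, Prop. 1.7 and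
Thm. 1.12; folklore] -/
theorem quotientChartClause_of_pointFedder (J : Finset (Fin n)) (V : Matrix (Fin n) (Fin n) ℕ) (g : MvPolynomial (Fin n) k)
    (hg0 : g ≠ 0) (hX : ∀ i : Fin n, ¬ (MvPolynomial.X i ∣ g))
    (hfed : ∀ (K : Type) [Field K] [Algebra k K] (b : Fin n → K), MvPolynomial.aeval b g = 0 →
      (∀ j ∈ J, MvPolynomial.aeval b (∏ i : Fin n, (X i : MvPolynomial (Fin n) k) ^ V i j) = 0) →
      (MvPolynomial.map (algebraMap k K) g) ^ (p - 1) ∉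
        Ideal.span (Set.range fun i : Fin n => (MvPolynomial.X i - MvPolynomial.C (b i)) ^ p)) :
    ∀ (Q' : Ideal (MvPolynomial (Fin n) k ⧸ Ideal.span {g})) [Q'.IsMaximal],
      (∀ j ∈ J, Ideal.Quotient.mk (Ideal.span {g})
        (aeval (fun j : Fin n => ∏ i : Fin n, (X i : MvPolynomial (Fin n) k) ^ V i j) (X j : MvPolynomial (Fin n) k)) ∈ Q') →
        (∀ i : Fin n, (X i : MvPolynomial (Fin n) k) ∈ Q'.comap (Ideal.Quotient.mk (Ideal.span {g})) →
          IsSMulRegular (Localization.AtPrime (Q'.comap (Ideal.Quotient.mk (Ideal.span {g}))) ⧸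
              (Ideal.span {g}).map (algebraMap (MvPolynomial (Fin n) k)
                (Localization.AtPrime (Q'.comap (Ideal.Quotient.mk (Ideal.span {g}))))))
            (algebraMap (MvPolynomial (Fin n) k)
              (Localization.AtPrime (Q'.comap (Ideal.Quotient.mk (Ideal.span {g})))) (X i))) ∧
        ∀ dd : ℕ, ringKrullDim (Localization.AtPrime Q') = dd → ∀ s : Fin dd → Localization.AtPrime Q',
          (Ideal.span (Set.range s)).radical.IsMaximal →
            RingTheory.Sequence.IsWeaklyRegular (Localization.AtPrime Q') (List.ofFn s) ∧
            ∀ y : Localization.AtPrime Q', (∃ e : ℕ, y ^ p ^ e ∈ Ideal.span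
              ((fun z : Localization.AtPrime Q' => z ^ p ^ e) ''
                (Ideal.span (Set.range s) : Set (Localization.AtPrime Q')))) → y ∈ Ideal.span (Set.range s) := by
  intro Q' _ hθ
  classical
  -- the contraction `P`, residue field `K = k[Y]/P`, residue point `b`
  set P : Ideal (MvPolynomial (Fin n) k) := Q'.comap (Ideal.Quotient.mk (Ideal.span {g})) with hP_def
  haveI hPmax : P.IsMaximal := Ideal.comap_isMaximal_of_surjective _ Ideal.Quotient.mk_surjective
  refine ⟨fun i _ => isSMulRegular_localization_quotient_of_prime_not_dvd P (PrimeTransfer.prime_X i) (hX i) _ rfl, ?_⟩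
  letI : Field (MvPolynomial (Fin n) k ⧸ P) := Ideal.Quotient.field P
  have hgP : g ∈ P := by
    rw [hP_def, Ideal.mem_comap, Ideal.Quotient.eq_zero_iff_mem.mpr (Ideal.mem_span_singleton_self g)]
    exact Q'.zero_mem
  have haev : ∀ q : MvPolynomial (Fin n) k,
      MvPolynomial.aeval (fun i : Fin n => Ideal.Quotient.mk P (MvPolynomial.X i)) q = Ideal.Quotient.mk P q := by
    intro q
    have h : (MvPolynomial.aeval (R := k) (fun i : Fin n => Ideal.Quotient.mk P (MvPolynomial.X i))) =
        Ideal.Quotient.mkₐ k P := MvPolynomial.algHom_ext fun i => by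
      rw [MvPolynomial.aeval_X, Ideal.Quotient.mkₐ_eq_mk]
    rw [h, Ideal.Quotient.mkₐ_eq_mk]
  have hgb : MvPolynomial.aeval (fun i : Fin n => Ideal.Quotient.mk P (MvPolynomial.X i)) g = 0 := by
    rw [haev, Ideal.Quotient.eq_zero_iff_mem]; exact hgP
  have hθb : ∀ j ∈ J, MvPolynomial.aeval (fun i : Fin n => Ideal.Quotient.mk P (MvPolynomial.X i))
      (∏ i : Fin n, (X i : MvPolynomial (Fin n) k) ^ V i j) = 0 := by
    intro j hj
    rw [haev, Ideal.Quotient.eq_zero_iff_mem, hP_def, Ideal.mem_comap]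
    have h := hθ j hj
    rwa [MvPolynomial.aeval_X] at h
  -- Fedder at the residue point, `g^(p-1) ∉ P^[p]` (C3a), generators of `P`, then the clause
  have hfed' := hfed (MvPolynomial (Fin n) k ⧸ P) (fun i : Fin n => Ideal.Quotient.mk P (MvPolynomial.X i)) hgb hθb
  have hfrobP := FrobeniusPowerOfFedderAt.frobeniusPower_of_fedderAt p k n g P hfed'
  obtain ⟨m, gens, hgens⟩ := Submodule.fg_iff_exists_fin_generating_family.mp
    ((isNoetherianRing_iff_ideal_fg _).mp inferInstance P)
  have hfed'' : g ^ (p - 1) ∉ Ideal.span (Set.range fun i : Fin m => gens i ^ p) := by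
    intro h
    apply hfrobP
    refine (Ideal.span_le.mpr ?_) h
    rintro _ ⟨i, rfl⟩
    exact pow_mem_frobeniusPower (by rw [← hgens]; exact Submodule.subset_span ⟨i, rfl⟩)
  exact FedderAtMaximalIdeal.stub_fedderAtMaximalIdeal p k n m gens g Q' hgens.symm hg0 hfed''

/-- **THE COVER AND THE CELLS ⟹ FEDDER AT EVERY POINT UNDER THE CENTRE.** If every `T ⊆ Fin n` meeting the support of each column
`j ∈ J` of `V` contains a listed stratum `S ∈ SS`, and every listed stratum carries a cell (§2), then Fedder's test holds for `g ⊗ K`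
at every `K`-point `b` with `g(b) = 0` and `θ(X_j)(b) = 0 (j ∈ J)`: the orthant `T = {i : b_i = 0}` meets every column (a vanishing
product of powers in a field has a vanishing factor with positive exponent). [folklore; cite: Fedder1983, Prop. 1.7] -/
theorem pointFedder_of_kLocCells (J : Finset (Fin n)) (V : Matrix (Fin n) (Fin n) ℕ) (g : MvPolynomial (Fin n) k)
    (SS : List (Finset (Fin n)))
    (hcov : ∀ T : Finset (Fin n), (∀ j ∈ J, ∃ i ∈ T, 0 < V i j) → ∃ S ∈ SS, S ⊆ T)
    (hcells : ∀ S ∈ SS, ∃ (L : List ((Fin n →₀ ℕ) × MvPolynomial (Fin n) k)) (rr : List (MvPolynomial (Fin n) k))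
        (t : Fin n → MvPolynomial (Fin n) k) (t₀ : MvPolynomial (Fin n) k),
        (L.map Prod.fst).Nodup ∧ (∀ e ∈ L, ∀ i : Fin n, e.1 i < p) ∧
        g ^ (p - 1) = (L.map fun e => MvPolynomial.monomial e.1 (1 : k) * MvPolynomial.expand p e.2).sum ∧
        (1 : MvPolynomial (Fin n) k) = (List.zipWith (fun r e => r * MvPolynomial.expand p e.2) rr L).sum +
          ∑ i ∈ S, t i * MvPolynomial.X i + t₀ * g)
    (K : Type) [Field K] [Algebra k K] (b : Fin n → K) (hgb : MvPolynomial.aeval b g = 0)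
    (hθ : ∀ j ∈ J, MvPolynomial.aeval b (∏ i : Fin n, (X i : MvPolynomial (Fin n) k) ^ V i j) = 0) :
    (MvPolynomial.map (algebraMap k K) g) ^ (p - 1) ∉
        Ideal.span (Set.range fun i : Fin n => (MvPolynomial.X i - MvPolynomial.C (b i)) ^ p) := by
  classical
  -- the orthant of `b` meets every column of `V` indexed by `J`
  have hT : ∀ j ∈ J, ∃ i ∈ (Finset.univ.filter fun i : Fin n => b i = 0), 0 < V i j := by
    intro j hj
    have h := hθ j hj
    rw [map_prod, Finset.prod_eq_zero_iff] at h
    obtain ⟨i, -, hi⟩ := h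
    rw [map_pow, MvPolynomial.aeval_X, pow_eq_zero_iff'] at hi
    exact ⟨i, Finset.mem_filter.mpr ⟨Finset.mem_univ i, hi.1⟩, Nat.pos_of_ne_zero hi.2⟩
  obtain ⟨S, hS, hST⟩ := hcov _ hT
  obtain ⟨L, rr, t, t₀, hnd, hbd, hsplit, hcof⟩ := hcells S hS
  exact fedderAt_of_kLocCell p k n S g L rr t t₀ hnd hbd hsplit hcof K b (fun i hi => (Finset.mem_filter.mp (hST hi)).2) hgb

/-- **(G2, glued) `hon'` OF ONE HYPERSURFACE CHART FROM ITS STRATUM CELLS** (`L/w45a/ToricCertSig.lean` v1.1 `dfad821d8a675d80` §3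
`stub_honQuot_of_kLocCells`, VERBATIM): for a chart polynomial `g ≠ 0` divisible by no variable, exceptional monomials
`θ(X_j) = ∏_i Y_i^(V i j)` (`j ∈ J`), a list `SS` of strata with the COVER condition and one §2-cell per listed stratum, the `hon'` binder
of `CICertificates.ciCertificates` at `r = 1` (written with `Ideal.span {g}`) holds. `pointFedder_of_kLocCells` ∘
`quotientChartClause_of_pointFedder`. [folklore; cite: Fedder1983, Prop. 1.7 and Thm. 1.12] -/
theorem honQuot_of_kLocCells : ∀ (p : ℕ) [Fact p.Prime] (k : Type) [Field k] [CharP k p] (n : ℕ)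
    (J : Finset (Fin n)) (V : Matrix (Fin n) (Fin n) ℕ) (g : MvPolynomial (Fin n) k), g ≠ 0 → (∀ i : Fin n, ¬ (MvPolynomial.X i ∣ g)) →
    ∀ (SS : List (Finset (Fin n))),
    (∀ T : Finset (Fin n), (∀ j ∈ J, ∃ i ∈ T, 0 < V i j) → ∃ S ∈ SS, S ⊆ T) →
    (∀ S ∈ SS, ∃ (L : List ((Fin n →₀ ℕ) × MvPolynomial (Fin n) k)) (rr : List (MvPolynomial (Fin n) k))
        (t : Fin n → MvPolynomial (Fin n) k) (t₀ : MvPolynomial (Fin n) k),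
        (L.map Prod.fst).Nodup ∧ (∀ e ∈ L, ∀ i : Fin n, e.1 i < p) ∧
        g ^ (p - 1) = (L.map fun e => MvPolynomial.monomial e.1 (1 : k) * MvPolynomial.expand p e.2).sum ∧
        (1 : MvPolynomial (Fin n) k) = (List.zipWith (fun r e => r * MvPolynomial.expand p e.2) rr L).sum +
          ∑ i ∈ S, t i * MvPolynomial.X i + t₀ * g) →
    ∀ (Q' : Ideal (MvPolynomial (Fin n) k ⧸ Ideal.span {g})) [Q'.IsMaximal],
      (∀ j ∈ J, Ideal.Quotient.mk (Ideal.span {g})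
        (aeval (fun j : Fin n => ∏ i : Fin n, (X i : MvPolynomial (Fin n) k) ^ V i j) (X j : MvPolynomial (Fin n) k)) ∈ Q') →
        (∀ i : Fin n, (X i : MvPolynomial (Fin n) k) ∈ Q'.comap (Ideal.Quotient.mk (Ideal.span {g})) →
          IsSMulRegular (Localization.AtPrime (Q'.comap (Ideal.Quotient.mk (Ideal.span {g}))) ⧸
              (Ideal.span {g}).map (algebraMap (MvPolynomial (Fin n) k)
                (Localization.AtPrime (Q'.comap (Ideal.Quotient.mk (Ideal.span {g}))))))
            (algebraMap (MvPolynomial (Fin n) k)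
              (Localization.AtPrime (Q'.comap (Ideal.Quotient.mk (Ideal.span {g})))) (X i))) ∧
        ∀ dd : ℕ, ringKrullDim (Localization.AtPrime Q') = dd → ∀ s : Fin dd → Localization.AtPrime Q',
          (Ideal.span (Set.range s)).radical.IsMaximal →
            RingTheory.Sequence.IsWeaklyRegular (Localization.AtPrime Q') (List.ofFn s) ∧
            ∀ y : Localization.AtPrime Q', (∃ e : ℕ, y ^ p ^ e ∈ Ideal.span
              ((fun z : Localization.AtPrime Q' => z ^ p ^ e) ''
                (Ideal.span (Set.range s) : Set (Localization.AtPrime Q')))) → y ∈ Ideal.span (Set.range s):= by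
  intro p _ k _ _ n J V g hg0 hX SS hcov hcells
  exact quotientChartClause_of_pointFedder p k n J V g hg0 hX fun K _ _ b hgb hθ =>
    pointFedder_of_kLocCells p k n J V g SS hcov hcells K b hgb hθ

end Chart

end Summit.ResolutionOfSingularities.ResolutionOfSingularities.Theorems.FInjectiveMacaulayfication.KLocCell

end
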